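import Summits.BirchSwinnertonDyer.Rank1Residual.GaloisImage.CongruenceVisibilityWitness
import HarnessLib

/-!
# Visibility with a TWISTED-DIVISIBLE witness: criterion (d) for the local condition at a hard place
# (cell `b2b-bsdres`, team n1011, seat p10 GEN 8; proposed row T-VIS3-UC "the unramified-cubic witness
# road at the additive prime 3", FILE 1; note `HOME/b2b-bsdres-n1011-p10/g8/L41-NOTE.md` §3)

HONEST FRAMING (cell `b2b-bsdres`, run/shared/lean/b2b/bsd-rank1-residual/, verbatim in every
file): the goal of the cell is to DELETE the COMBINATION-SHAPED residual classes of the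
Birch–Swinnerton-Dyer formula for ALL analytic-rank `≤ 1` elliptic curves over `ℚ` — "full BSD
formula for every rank `≤ 1` curve in class `C`" assembled STRICTLY from published theorems — so
that the rank-`≤ 1` remainder becomes exactly the CONSTRUCTION-SHAPED classes, which are TYPED
(missing-input `Prop`s), NOT attempted. This is not "finishing BSD". Team n1011 (N10 / N11):
research route on the CONSTRUCTION-SHAPED class X4 (§I N11 LOWER half); no claim beyond the stated
classes; nothing is booked; marks UNCHANGED. Theorems only: no definition, no named fact, no
`sorry`. TOOL theorems (any field `K` of characteristic `0`, any `K`-field `E`, any `n ≠ 0`); they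
close nothing by themselves.

## What

The tree's explicit-witness form of congruence visibility
(`Summits/…/GaloisImage/CongruenceVisibilityWitness.lean`, seat p09:
`VisibleWitness.exists_sha_ne_zero_of_congr_of_witness`) asks, at each hard place `v`, that the
transported Kummer class `θ_* κ'(P)` of the witness `P ∈ E'(K)` satisfy the local condition of `E`
(`h1Equiv θ hθ (kummerMapTorsion W' n hdiv' P) ∈ selmerLocalKer W K_v n`), and offers three
criteria: (a) `P` is `n`-divisible in `E'(K_v)` (then the class restricts to ZERO), (b)
`#𝓛_v(E') = 1`, (c) `ι_v(θ) = 1`. This file adds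

**criterion (d) — twisted divisibility.** Let `H ⊴ Γ_{K_v}` be a normal subgroup with cyclic
quotient generated by `F` (think: `H = Γ_M` for `M/K_v` the unramified extension of prime degree
`p = n`), such that every `n`-torsion point of `E(K̄_v)` or `E'(K̄_v)` fixed by `H` is fixed by
`Γ_{K_v}` and the `Γ_{K_v}`-fixed `n`-torsion of `E(K̄_v)` is "rank one" (any fixed `n`-torsion
point is an integer multiple of any non-zero one — e.g. it has prime order `p = n`). IF
(d1) `P = n • Q'` for some `H`-fixed `Q' ∈ E'(K̄_v)` ("`P` is `n`-divisible in `E'(M)`"), and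
(d2) there is an `H`-fixed `Q₁ ∈ E(K̄_v)`, NOT fixed by `F`, with `n • Q₁ ∈ E(K_v)` ("some
`K_v`-point of `E` is `n`-divisible in `E(M)` but not in `E(K_v)`"),
THEN `θ_* κ'(P)` satisfies the local condition of `E` at `K_v`
(`h1Equiv_kummerMapTorsion_mem_selmerLocalKer_of_twistedDivisible`).

Proof (cocycle level, Silverman *AEC* VIII.§2 / X.§4): `res_v κ'(P) = [σ ↦ σR' − R']` for a global
root `R'`; in `E'(K̄_v)`, `R' = Q' + τ'` with `τ'` an `n`-torsion point, so the cocycle is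
`(σQ' − Q') + ∂τ'`. The map `d'(σ) = σQ' − Q'` vanishes on `H`, has `n`-torsion `H`-fixed — hence
`Γ`-fixed — values, so it is a HOMOMORPHISM `Γ_{K_v}/H → E'[n]^Γ`, `d'(F^i h) = i·d'(F)`; likewise
`d₁(σ) = σQ₁ − Q₁` with `d₁(F) ≠ 0`. Transporting by `θ` (made local through the tree's torsion
comparison `torsionPointsEquiv`), `θ d'(F) = m·d₁(F)` by the rank-one hypothesis, hence
`θ∘d' = m·d₁ = ∂(m Q₁)` and `θ_* res_v κ'(P) = ∂(m Q₁ + θτ')` is a coboundary in `E(K̄_v)`.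

Over `ℚ` at `p = n = 3` with `M = ℚ₃(α)`, `α³ = α + 1` (the unramified cubic extension) this is the
"unramified-cubic witness road" of the note: the restriction kernel
`ker(H¹(ℚ₃,E[3]) → H¹(M,E[3]))` is the LINE spanned by `κ(3Q₁)`, and it contains `res₃ θ_*κ'(P)`.
Why (d2) holds on every curve with a `ℚ₃`-rational `3`-torsion point in the identity component and
why (d1) holds for one line of `E'(ℚ)/3` on every σ = E0/E0 pair of r1's census (5 170/5 170) is
the note's THEOREM A/B (Lang's theorem on the Néron identity component) — NOT used here: (d1)/(d2)
are INPUTS, to be certified per pair by the T-VIS3-WC deciders over the number field `ℚ(α)`.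

* §1 algebra of the difference maps `σ ↦ σ • Q − Q` (any group acting on any abelian group);
* §2 the local transport `θ_E` of `θ` to `n`-torsion of `E'(K̄_E) → E(K̄_E)` and its equivariance;
* §3 the criterion.

References: [SilvermanAEC2009] J. H. Silverman, *The Arithmetic of Elliptic Curves*, 2nd ed.,
VIII.§2 (Kummer pairing, inflation from a finite Galois extension: Prop. VIII.1.5 / proof of the
weak Mordell–Weil theorem), X.§4; [CremonaMazur2000] §3; [AgasheStein2002] Lemma 3.6.
-/

noncomputable section

open scoped Classical

namespace Summit.BirchSwinnertonDyer.Rank1Residual.GaloisImage.TwistedWitness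

open WeierstrassCurve Literature.NumberTheory.EllipticCurves Literature.NumberTheory.GaloisRepresentations
open Field

/-! ## §1 Difference maps `σ ↦ σ • Q − Q` -/

section Algebra

variable {Γ A : Type*} [Group Γ] [AddCommGroup A] [DistribMulAction Γ A]

/-- If the value `τ • Q − Q` is fixed by `σ`, then `(σ τ) • Q − Q = (σ • Q − Q) + (τ • Q − Q)`:
the difference map of `Q` is additive where its values are invariant. Silverman, *AEC*, VIII.§2
(the Kummer pairing is bilinear once `E[m] ⊆ E(K)`). [folklore] -/
theorem mul_smul_sub_eq_add (Q : A) (σ τ : Γ) (hfix : σ • (τ • Q - Q) = τ • Q - Q) :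
    (σ * τ) • Q - Q = (σ • Q - Q) + (τ • Q - Q) := by
  rw [mul_smul, ← hfix, smul_sub]
  abel

/-- For a normal subgroup `H` fixing `Q`, every value `τ • Q − Q` is fixed by `H`:
`h • (τ • Q − Q) = τ • ((τ⁻¹ h τ) • Q) − Q = τ • Q − Q`. [folklore] -/
theorem smul_sub_eq_of_normal {H : Subgroup Γ} (hH : H.Normal) (Q : A) (hQ : ∀ h ∈ H, h • Q = Q)
    (τ : Γ) {h : Γ} (hh : h ∈ H) : h • (τ • Q - Q) = τ • Q - Q := by
  have hconj : τ⁻¹ * h * τ ∈ H := by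
    have := hH.conj_mem' h hh τ
    simpa [mul_assoc] using this
  rw [smul_sub, hQ h hh, ← mul_smul, show h * τ = τ * (τ⁻¹ * h * τ) by group, mul_smul,
    hQ _ hconj]

/-- On `σ = F ^ i * h` with `h` fixing `Q`, a difference map with invariant values is
`i • (F • Q − Q)`: it is a homomorphism killing `H`. Silverman, *AEC*, VIII.§2. [folklore] -/
theorem pow_mul_smul_sub_eq_zsmul (Q : A) (F : Γ) (hfix : ∀ σ τ : Γ, σ • (τ • Q - Q) = τ • Q - Q)
    {h : Γ} (hh : h • Q = Q) (i : ℕ) :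
    (F ^ i * h) • Q - Q = (i : ℤ) • (F • Q - Q) := by
  rw [mul_smul_sub_eq_add Q _ _ (hfix _ _), hh, sub_self, add_zero]
  induction i with
  | zero => simp
  | succ i ih =>
    rw [pow_succ, mul_smul_sub_eq_add Q _ _ (hfix _ _), ih, Nat.cast_succ, add_zsmul, one_zsmul]

end Algebra

/-! ## §2 The local transport of `θ` on `n`-torsion -/

section Transport

variable {K : Type} [Field K] [CharZero K] (W W' : WeierstrassCurve K) [W'.IsElliptic]
  {n : ℤ} (hn : n ≠ 0) (θ : geomTorsion W' n ≃+ geomTorsion W n) (E : Type) [Field E] [Algebra K E]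

/-- `θ` read on the `n`-torsion of the `K̄_E`-points, with values in `E(K̄_E)`:
`T' ↦ ι(θ(ι'⁻¹ T'))` along the tree's torsion comparisons `torsionPointsEquiv` of `W'` and `W`
(all `n`-torsion of `E(K̄_E)` is algebraic over `K`, Silverman *AEC* III.6.4 / VII.§3). A plain
composite of additive maps, written as a term (no new definition is introduced). [folklore] -/
theorem localTransport_def (T' : AddSubgroup.torsionBy (localPoints W' E) n) :
    ((pointsMap W E).comp ((geomTorsion W n).subtype.comp
      (θ.toAddMonoidHom.comp (W'.torsionPointsEquiv n (E := E) hn).symm.toAddMonoidHom))) T' =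
      pointsMap W E (θ ((W'.torsionPointsEquiv n (E := E) hn).symm T') : geomTorsion W n) :=
  rfl

/-- The local transport on the image of a global torsion point: `ι(θ x)` for `x ∈ E'[n](K̄)` read in
`E'(K̄_E)`. [folklore] -/
theorem localTransport_apply_pointsMap (x : geomTorsion W' n)
    (hx : pointsMap W' E (x : geomPoints W') ∈ AddSubgroup.torsionBy (localPoints W' E) n) :
    pointsMap W E (θ ((W'.torsionPointsEquiv n (E := E) hn).symm
        ⟨pointsMap W' E (x : geomPoints W'), hx⟩) : geomTorsion W n) =
      pointsMap W E (θ x : geomTorsion W n) := by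
  have h : (W'.torsionPointsEquiv n (E := E) hn).symm ⟨pointsMap W' E (x : geomPoints W'), hx⟩ = x := by
    apply (W'.torsionPointsEquiv n (E := E) hn).injective
    rw [AddEquiv.apply_symm_apply]
    exact Subtype.ext (W'.coe_torsionPointsEquiv_apply n hn x).symm
  rw [h]

/-- Equivariance of the local transport: `ι(θ(ι'⁻¹ (σ • T'))) = σ • ι(θ(ι'⁻¹ T'))` for
`σ ∈ Γ_E` (from `hθ` along `resGal E` and the equivariance of the torsion comparisons).
[folklore] -/
theorem localTransport_smul
    (hθ : ∀ (σ : absoluteGaloisGroup K) (P : geomTorsion W' n), θ (σ • P) = σ • θ P)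
    (σ : absoluteGaloisGroup E) (T' : AddSubgroup.torsionBy (localPoints W' E) n) :
    pointsMap W E (θ ((W'.torsionPointsEquiv n (E := E) hn).symm (σ • T')) : geomTorsion W n) =
      σ • pointsMap W E (θ ((W'.torsionPointsEquiv n (E := E) hn).symm T') : geomTorsion W n) := by
  rw [W'.torsionPointsEquiv_symm_smul n hn σ T', hθ,
    Literature.NumberTheory.EllipticCurves.AddSubgroup.torsionBy.coe_smul, pointsMap_smul]

end Transport

/-! ## §3 Criterion (d): twisted divisibility -/

section Criterion

variable {K : Type} [Field K] [CharZero K] (W W' : WeierstrassCurve K) [W'.IsElliptic]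
  {n : ℤ} (θ : geomTorsion W' n ≃+ geomTorsion W n)
  (hθ : ∀ (σ : absoluteGaloisGroup K) (P : geomTorsion W' n), θ (σ • P) = σ • θ P)
  (E : Type) [Field E] [Algebra K E]

/-- **Criterion (d) — twisted divisibility.** Let `E = W`, `E' = W'` be elliptic curves over a
field `K` of characteristic `0`, `n ≠ 0`, `θ : E'[n] ⥲ E[n]` a `Γ_K`-isomorphism, `E` a `K`-field
(a completion `K_v`) with absolute Galois group `Γ = Γ_E`, `H ⊴ Γ` a normal subgroup and `F ∈ Γ`
such that every `σ ∈ Γ` is `F ^ i * h` with `h ∈ H` (e.g. `H = Γ_M` for a cyclic extension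
`M/K_v` generated over `H` by `F`). Assume: every `n`-torsion point of `E(K̄_E)`, resp. `E'(K̄_E)`,
fixed by `H` is fixed by `Γ` (`E[n](M) = E[n](K_v)`, `E'[n](M) = E'[n](K_v)`), and the `Γ`-fixed
`n`-torsion of `E(K̄_E)` is "rank one": every such point is an integer multiple of any non-zero one
(e.g. `E[n](K_v)` has prime order). Let `P ∈ E'(K)` with (d1) `P = n • Q'` for an `H`-fixed
`Q' ∈ E'(K̄_E)` and (d2) some `H`-fixed `Q₁ ∈ E(K̄_E)` with `n • Q₁` `Γ`-fixed and `F • Q₁ ≠ Q₁`.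
**Then the transported Kummer class `θ_* κ'(P)` satisfies the local condition of `E` at `K_v`.**
Indeed `res_v θ_* κ'(P) = m • κ_v(n • Q₁) + 0` for some `m ∈ ℤ`: the restriction kernel
`ker(H¹(K_v, E[n]) → H¹(M, E[n]))` is spanned by the local Kummer class of `n • Q₁`. Silverman,
*AEC*, VIII.§2, X.§4; Cremona–Mazur 2000 §3 (explicit visibility). [folklore] -/
theorem h1Equiv_kummerMapTorsion_mem_selmerLocalKer_of_twistedDivisible (hn : n ≠ 0)
    (hdiv' : ∀ P : geomPoints W', ∃ Q : geomPoints W', n • Q = P) (P : W'.toAffine.Point)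
    (H : Subgroup (absoluteGaloisGroup E)) (hH : H.Normal) (F : absoluteGaloisGroup E)
    (hgen : ∀ σ : absoluteGaloisGroup E, ∃ (i : ℕ) (h : absoluteGaloisGroup E), h ∈ H ∧ σ = F ^ i * h)
    (hfixW : ∀ T : localPoints W E, n • T = 0 → (∀ h ∈ H, h • T = T) →
      ∀ σ : absoluteGaloisGroup E, σ • T = T)
    (hfixW' : ∀ T : localPoints W' E, n • T = 0 → (∀ h ∈ H, h • T = T) →
      ∀ σ : absoluteGaloisGroup E, σ • T = T)
    (hcyc : ∀ T₁ T₂ : localPoints W E, n • T₁ = 0 → n • T₂ = 0 →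
      (∀ σ : absoluteGaloisGroup E, σ • T₁ = T₁) → (∀ σ : absoluteGaloisGroup E, σ • T₂ = T₂) →
      T₁ ≠ 0 → ∃ m : ℤ, T₂ = m • T₁)
    (Q' : localPoints W' E) (hQ'H : ∀ h ∈ H, h • Q' = Q')
    (hQ' : n • Q' = pointsMap W' E (toGeomPoints W' P))
    (Q₁ : localPoints W E) (hQ₁H : ∀ h ∈ H, h • Q₁ = Q₁)
    (hQ₁ : n • Q₁ ∈ MulAction.fixedPoints (absoluteGaloisGroup E) (localPoints W E))
    (hQ₁F : F • Q₁ ≠ Q₁) :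
    h1Equiv θ hθ (kummerMapTorsion W' n hdiv' P) ∈ selmerLocalKer W E n := by
  -- the global root `R'` and its Kummer cocycle
  set R' : geomPoints W' := zsmulRoot W' n hdiv' P with hR'def
  have hR' : n • R' = toGeomPoints W' P := zsmul_zsmulRoot W' n hdiv' P
  rw [kummerMapTorsion_apply]
  unfold kummerMapTorsionFun kummerClassTorsion
  rw [h1Equiv_oneCocycleClass, selmerLocalKer, oneCocycleClass_mem_resKer_iff]
  -- local names
  set ιθ : AddSubgroup.torsionBy (localPoints W' E) n →+ localPoints W E :=
    (pointsMap W E).comp ((geomTorsion W n).subtype.comp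
      (θ.toAddMonoidHom.comp (W'.torsionPointsEquiv n (E := E) hn).symm.toAddMonoidHom)) with hιθ
  have hιθ_apply : ∀ T', ιθ T' =
      pointsMap W E (θ ((W'.torsionPointsEquiv n (E := E) hn).symm T') : geomTorsion W n) :=
    fun T' ↦ rfl
  have hιθ_smul : ∀ (σ : absoluteGaloisGroup E) T', ιθ (σ • T') = σ • ιθ T' := fun σ T' ↦ by
    rw [hιθ_apply, hιθ_apply, localTransport_smul W W' hn θ E hθ σ T']
  -- the local point `P_E` is `Γ_E`-fixed
  have hPfix : ∀ σ : absoluteGaloisGroup E,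
      σ • pointsMap W' E (toGeomPoints W' P) = pointsMap W' E (toGeomPoints W' P) := fun σ ↦ by
    rw [← pointsMap_smul, toGeomPoints_mem_fixedPoints W' P]
  have hQ'fix : n • Q' ∈ MulAction.fixedPoints (absoluteGaloisGroup E) (localPoints W' E) :=
    fun σ ↦ by rw [hQ', hPfix σ]
  -- `τ' = R'_E − Q'` is `n`-torsion
  set τ' : localPoints W' E := pointsMap W' E R' - Q' with hτ'def
  have hτ' : τ' ∈ AddSubgroup.torsionBy (localPoints W' E) n := by
    change n • τ' = 0
    rw [hτ'def, zsmul_sub, ← map_zsmul, hR', hQ', sub_self]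
  -- the difference maps `d'(σ) = σ • Q' − Q'` and `d₁(σ) = σ • Q₁ − Q₁`
  have hd'tors : ∀ σ : absoluteGaloisGroup E, n • (σ • Q' - Q') = 0 := fun σ ↦
    smul_sub_mem_torsionBy_localPoints hQ'fix σ
  have hd'fix : ∀ σ τ : absoluteGaloisGroup E, σ • (τ • Q' - Q') = τ • Q' - Q' := fun σ τ ↦
    hfixW' _ (hd'tors τ) (fun h hh ↦ smul_sub_eq_of_normal hH Q' hQ'H τ hh) σ
  have hd₁tors : ∀ σ : absoluteGaloisGroup E, n • (σ • Q₁ - Q₁) = 0 := fun σ ↦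
    smul_sub_mem_torsionBy_localPoints hQ₁ σ
  have hd₁fix : ∀ σ τ : absoluteGaloisGroup E, σ • (τ • Q₁ - Q₁) = τ • Q₁ - Q₁ := fun σ τ ↦
    hfixW _ (hd₁tors τ) (fun h hh ↦ smul_sub_eq_of_normal hH Q₁ hQ₁H τ hh) σ
  -- `θ d'(F) = m • d₁(F)`
  set D' : AddSubgroup.torsionBy (localPoints W' E) n := ⟨F • Q' - Q', hd'tors F⟩ with hD'def
  have hD'fix : ∀ σ : absoluteGaloisGroup E, σ • D' = D' := fun σ ↦
    Subtype.ext (by rw [Literature.NumberTheory.EllipticCurves.AddSubgroup.torsionBy.coe_smul]; exact hd'fix σ F)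
  have hyfix : ∀ σ : absoluteGaloisGroup E, σ • ιθ D' = ιθ D' := fun σ ↦ by
    rw [← hιθ_smul, hD'fix σ]
  have hytors : n • ιθ D' = 0 := by
    rw [← map_zsmul]
    have : n • D' = 0 := Subtype.ext (by
      rw [AddSubgroupClass.coe_zsmul]; exact hd'tors F)
    rw [this, map_zero]
  have hx0 : F • Q₁ - Q₁ ≠ 0 := fun h0 ↦ hQ₁F (sub_eq_zero.mp h0)
  obtain ⟨m, hm⟩ := hcyc (F • Q₁ - Q₁) (ιθ D') (hd₁tors F) hytors (fun σ ↦ hd₁fix σ F) hyfix hx0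
  -- the explaining point
  refine ⟨m • Q₁ + ιθ ⟨τ', hτ'⟩, fun σ ↦ ?_⟩
  obtain ⟨i, h, hh, rfl⟩ := hgen σ
  -- the value of the global Kummer cocycle at `ρ = resGal (F^i h)`, a global `n`-torsion point
  set x : geomTorsion W' n := (kummerCocycleTorsion W' n R' (zsmul_zsmulRoot_mem W' n hdiv' P)).1
    (resGal (K := K) E (F ^ i * h)) with hxdef
  have hxval : pointsMap W' E (x : geomPoints W') =
      (F ^ i * h) • pointsMap W' E R' - pointsMap W' E R' := by
    rw [hxdef, coe_kummerCocycleTorsion_apply, map_sub, pointsMap_smul]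
  have hxmem : pointsMap W' E (x : geomPoints W') ∈ AddSubgroup.torsionBy (localPoints W' E) n := by
    change n • pointsMap W' E (x : geomPoints W') = 0
    rw [← map_zsmul, (mem_geomTorsion_iff W' n _).mp x.2, map_zero]
  change pointsMap W E ((θ x : geomTorsion W n) : geomPoints W) = _
  rw [← localTransport_apply_pointsMap W W' hn θ E x hxmem, ← hιθ_apply]
  -- decompose the local value: `σR'_E − R'_E = (σQ' − Q') + (στ' − τ') = i • D' + ∂τ'(σ)`
  have hdecomp : (⟨pointsMap W' E (x : geomPoints W'), hxmem⟩ :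
      AddSubgroup.torsionBy (localPoints W' E) n) =
        (i : ℤ) • D' + ((F ^ i * h) • (⟨τ', hτ'⟩ : AddSubgroup.torsionBy (localPoints W' E) n) -
          ⟨τ', hτ'⟩) := by
    apply Subtype.ext
    rw [AddSubgroup.coe_add, AddSubgroup.coe_sub, AddSubgroupClass.coe_zsmul,
      Literature.NumberTheory.EllipticCurves.AddSubgroup.torsionBy.coe_smul]
    change pointsMap W' E (x : geomPoints W') = (i : ℤ) • (F • Q' - Q') + ((F ^ i * h) • τ' - τ')
    rw [hxval, ← pow_mul_smul_sub_eq_zsmul Q' F hd'fix (hQ'H h hh) i, hτ'def, smul_sub]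
    abel
  have hQ₁val : (F ^ i * h) • Q₁ = (i : ℤ) • (F • Q₁ - Q₁) + Q₁ := by
    rw [← pow_mul_smul_sub_eq_zsmul Q₁ F hd₁fix (hQ₁H h hh) i, sub_add_cancel]
  rw [hdecomp, map_add, map_sub, map_zsmul, hιθ_smul, hm, smul_add,
    W.smul_zsmul_localPoints m (F ^ i * h) Q₁, hQ₁val]
  generalize (F ^ i * h) • ιθ ⟨τ', hτ'⟩ = b
  generalize ιθ ⟨τ', hτ'⟩ = a
  generalize F • Q₁ = q
  module

end Criterion

/-! ## §4 The certificate shape with criterion (d) at one distinguished place -/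

section Main

open NumberField IsDedekindDomain

variable {K : Type} [Field K] [NumberField K] (W W' : WeierstrassCurve K) [W.IsElliptic]
  [W'.IsElliptic] {p : ℕ} [Fact p.Prime]

/-- **Visibility with a twisted-divisible witness at one hard place.** Let `p` be an odd prime,
`θ : E'[p] ⥲ E[p]` a `Γ_K`-isomorphism, `S` a finite set of finite places containing the bad
places of `E`, `E'` and the places above `p`, `E(K)` finite of order prime to `p`,
`P ∈ E'(K) ∖ pE'(K)`, and `v₀ ∈ S` a distinguished place. Suppose that at every `v ∈ S`, `v ≠ v₀`,
EITHER `P|_{K_v}` has a `p`-th root in `E'(K_v)` (criterion (a)) OR the local conditions agree along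
`θ` at `v` (`ι_v(θ) = 1`, criterion (c), the tree's free kinds), and that at `v₀` the data of
criterion (d) are given: a normal subgroup `H ⊴ Γ_{K_{v₀}}` with quotient generated by `F`,
`p`-torsion of `E`, `E'` over `K̄_{v₀}` fixed by `H` being fixed by `Γ_{K_{v₀}}`, rank-one fixed
`p`-torsion of `E`, an `H`-fixed `p`-th root `Q'` of `P` in `E'(K̄_{v₀})` and an `H`-fixed `Q₁`
with `p • Q₁ ∈ E(K_{v₀})`, `F • Q₁ ≠ Q₁`. **Then `Ш(E/K)` has a non-zero element killed by `p`**
(`VisibleWitness.exists_sha_ne_zero_of_congr_of_witness` with criterion (d) at `v₀`). Over `ℚ` at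
`p = 3`, `v₀ = 3`, `H = Γ_{ℚ₃(α)}`, `α³ = α + 1`: the unramified-cubic witness road of the note.
[folklore] -/
theorem exists_sha_ne_zero_of_congr_of_twistedDivisible (hp2 : p ≠ 2)
    (θ : geomTorsion W' (p : ℤ) ≃+ geomTorsion W (p : ℤ))
    (hθ : ∀ (σ : absoluteGaloisGroup K) (P : geomTorsion W' (p : ℤ)), θ (σ • P) = σ • θ P)
    (S : Finset (HeightOneSpectrum (𝓞 K)))
    (hS : ∀ v : HeightOneSpectrum (𝓞 K), v ∉ S →
      W.HasGoodReductionAt v ∧ W'.HasGoodReductionAt v ∧ (p : 𝓞 K) ∉ v.asIdeal)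
    (hfin : Finite W.toAffine.Point) (hcop : (Nat.card W.toAffine.Point).Coprime p)
    (P : W'.toAffine.Point)
    (hP : P ∉ (zsmulAddGroupHom (p : ℤ) : W'.toAffine.Point →+ W'.toAffine.Point).range)
    (v₀ : HeightOneSpectrum (𝓞 K))
    (hoff : ∀ v ∈ S, v ≠ v₀ →
      (∃ Q : (W'.baseChange (v.adicCompletion K)).toAffine.Point,
        p • Q = WeierstrassCurve.Affine.Point.baseChange (W' := W') K (v.adicCompletion K) P) ∨
      (selmerLocalKer W (v.adicCompletion K) (p : ℤ)).relIndex
        ((selmerLocalKer W' (v.adicCompletion K) (p : ℤ)).map (h1Equiv θ hθ).toAddMonoidHom) = 1)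
    (H : Subgroup (absoluteGaloisGroup (v₀.adicCompletion K))) (hH : H.Normal)
    (F : absoluteGaloisGroup (v₀.adicCompletion K))
    (hgen : ∀ σ : absoluteGaloisGroup (v₀.adicCompletion K),
      ∃ (i : ℕ) (h : absoluteGaloisGroup (v₀.adicCompletion K)), h ∈ H ∧ σ = F ^ i * h)
    (hfixW : ∀ T : localPoints W (v₀.adicCompletion K), (p : ℤ) • T = 0 → (∀ h ∈ H, h • T = T) →
      ∀ σ : absoluteGaloisGroup (v₀.adicCompletion K), σ • T = T)
    (hfixW' : ∀ T : localPoints W' (v₀.adicCompletion K), (p : ℤ) • T = 0 → (∀ h ∈ H, h • T = T) →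
      ∀ σ : absoluteGaloisGroup (v₀.adicCompletion K), σ • T = T)
    (hcyc : ∀ T₁ T₂ : localPoints W (v₀.adicCompletion K), (p : ℤ) • T₁ = 0 → (p : ℤ) • T₂ = 0 →
      (∀ σ : absoluteGaloisGroup (v₀.adicCompletion K), σ • T₁ = T₁) →
      (∀ σ : absoluteGaloisGroup (v₀.adicCompletion K), σ • T₂ = T₂) → T₁ ≠ 0 → ∃ m : ℤ, T₂ = m • T₁)
    (Q' : localPoints W' (v₀.adicCompletion K)) (hQ'H : ∀ h ∈ H, h • Q' = Q')
    (hQ' : (p : ℤ) • Q' = pointsMap W' (v₀.adicCompletion K) (toGeomPoints W' P))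
    (Q₁ : localPoints W (v₀.adicCompletion K)) (hQ₁H : ∀ h ∈ H, h • Q₁ = Q₁)
    (hQ₁ : (p : ℤ) • Q₁ ∈ MulAction.fixedPoints (absoluteGaloisGroup (v₀.adicCompletion K))
      (localPoints W (v₀.adicCompletion K)))
    (hQ₁F : F • Q₁ ≠ Q₁) :
    ∃ c : W.sha, c ≠ 0 ∧ p • c = 0 := by
  have hp : p.Prime := Fact.out
  have hn : (p : ℤ) ≠ 0 := by exact_mod_cast hp.ne_zero
  have hdiv' : ∀ P : geomPoints W', ∃ Q : geomPoints W', (p : ℤ) • Q = P :=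
    W'.zsmul_geomPoints_surjective_holds hn
  have hE : (zsmulAddGroupHom (p : ℤ) : W.toAffine.Point →+ W.toAffine.Point).range = ⊤ := by
    rw [← AddSubgroup.index_eq_one]
    exact index_range_zsmul_eq_one_of_coprime hcop
  refine VisibleWitness.exists_sha_ne_zero_of_congr_of_witness W W' hp2 θ hθ S hS hdiv' hE P hP
    fun v hv ↦ ?_
  by_cases hv₀ : v = v₀
  · subst hv₀
    exact h1Equiv_kummerMapTorsion_mem_selmerLocalKer_of_twistedDivisible W W' θ hθ
      (v.adicCompletion K) hn hdiv' P H hH F hgen hfixW hfixW' hcyc Q' hQ'H hQ' Q₁ hQ₁H hQ₁ hQ₁F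
  · rcases hoff v hv hv₀ with ⟨Q, hQ⟩ | hone
    · exact VisibleWitness.h1Equiv_kummerMapTorsion_mem_selmerLocalKer_of_exists_smul_eq W W' θ hθ
        (v.adicCompletion K) hn hdiv' P ⟨Q, by rw [natCast_zsmul]; exact hQ⟩
    · exact VisibleWitness.h1Equiv_kummerMapTorsion_mem_selmerLocalKer_of_relIndex_eq_one W W' θ hθ
        (v.adicCompletion K) hdiv' P hone

end Main

end Summit.BirchSwinnertonDyer.Rank1Residual.GaloisImage.TwistedWitness

end
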